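/- Copyright: cell `pub-balaban-gaps` (YM BLITZ Y1, track G2), seat ne6 = row NE7b, gen 6 — an (A1c)-facing GENERIC supplier
for the NE7b crux team's tower END; the same-level design is the `t4-ne7b-formalise-leaf-04` lineage's OFF-TREE probe
(gen 23, `g23/q1/RelPosOpProbe.NOT-TO-FILE.lean`: «a Bochner fibre integral against a finite measure IS a relative positive
additive operation»), here made CROSS-LEVEL over Mathlib's transition kernels and joined to the END's one-step displays.
Released under the licence of the surrounding project. -/
import Mathlib.Probability.Kernel.Composition.IntegralCompProd
import Mathlib.Probability.Kernel.Composition.MeasureComp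
import Summits.QuantumFields.BalabanUV.T4Continuum.Support.B16HistoryReprChain

/-!
# `T4Continuum.Spine.NE7b.StepKernelOps` — row NE7b, (α)-instance, (A1c)-facing and GENERIC: a tower step GIVEN BY A FINITE
# TRANSITION KERNEL is a `RelLinPosHom` between the bounded-measurable classes of two levels; its weight `T1` IS the kernel's
# mass; the END's per-(step, choice) integral identity `hstep` IS ONE measure identity per (step, choice); the END's
# decomposition of unity `hunit` IS the powerset expansion of `Π_c ((1 − χ_c) + χ_c) = 1`
# (cell `pub-balaban-gaps`, seat ne6 gen 6; record `HOME/ne/NE7b.md` §6 (10))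

HONEST FRAMING.  Finite four-torus programme, rung (B)+1 only — NOT infinite volume, NOT a mass gap, NOT the Clay problem, NOT
summit progress, NOT a proof of NE7b (`Literature.….T4WeightBudget.RelWeightBound`, the cell's OWN estimate — NOT PRINTED in
[Bałaban 1983–89], NOT PROVED; INSTANCE 0∕1).  Nothing of Bałaban's is asserted, valued or discharged: every declaration is
[folklore] measure theory over Mathlib's `ProbabilityTheory.Kernel` and the tree's `B16HistoryReprChain` (`bddMeas`,
`RelLinPosHom`, `Tower`), or `Finset` algebra.  WHICH kernels are Bałaban's one-step operations 𝐓^{(j)}(Z_{j+1}, 𝔄_j) of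
[B16] (1.72) p. 379 — the (A1c) DATA of the NE7b owner lineage's `SCOPE-alpha.md`, behind NEEDS-COORDINATOR NC-NE7b-α — is NOT
touched here.  Spine PROVED 0∕9 — unchanged.

WHY.  After THE ROUNDED END (`Support/B16HistoryTowerEndLWRP82.continuumYM4Torus_of_towerReadingLWR_fsc`, p347728) and the
owner's DRESSING leaf (`Support/B16HistoryTowerEndDressing`, IR-102-1), what the tower record still DISPLAYS of Bałaban's kind at
ONE STEP is: (i) that each one-step operation `op j g p` IS a `RelLinPosHom (𝒢 j) (𝒢 (j+1))` at all (the tree holds only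
`RelLinPosHom.id ∕ comp` and toy instances over `GoodClass.top Unit` — NO measure-theoretic constructor); (ii) the per-(step,
choice) integral identity `hstep : ∫ (op j g p) f dν_{j+1} = ∫ χ_{j,g,p}·f dν_j` for ALL good `f`; (iii) the decomposition of
unity `hunit : Σ_{p ∈ branch j g} χ_{j,g,p} ≡ 1`; (iv) the weight envelope `op j g p 1 ≤ w` behind `HwPinned`.  This file
supplies the generic constructor and reads (ii)–(iv) ONE LEVEL LOWER, where an instance can discharge them by computation:
* §1 `ofKernel κ : RelLinPosHom (bddMeas X) (bddMeas Y)` for a FINITE transition kernel `κ : Kernel Y X` (for each configuration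
  `y` of the target level a finite measure `κ y` on the source level; `(ofKernel κ).T f y = ∫ f d(κ y)`): class preservation =
  Mathlib's `StronglyMeasurable.integral_kernel` + the mass letter `κ.bound`; monotone ∕ additive ∕ homogeneous on the class =
  `integral_mono ∕ integral_add ∕ integral_const_mul`.  `ofKernel_one`: THE WEIGHT `T1 y` IS THE MASS `(κ y)(univ)`, so the
  END's envelope display (iv) is a mass bound (`ofKernel_one_le`); `comp_ofKernel_apply`: kernel steps COMPOSE as kernels
  (`RelLinPosHom.comp` of two kernel steps = the kernel step of `Kernel.comp`, on the class), so a one-step operation assembled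
  from several factors may be presented as ONE kernel.
* §2 `integral_ofKernel`: `∫ (ofKernel κ).T f dν' = ∫ f d(κ ∘ₘ ν')` (Mathlib `Kernel.integral_comp`); hence **`hstep_of_comp_eq`**:
  the identity (ii) for ALL good `f` follows from the ONE measure identity `κ ∘ₘ ν' = χ·ν` (`Measure.withDensity`); and
  **`hstep_of_kernels`** = (ii) in the END's binder shape (`B16HistoryTowerEndDressing.H2A_bddMeas`'s `hstep`, on `j < K`,
  `K₀ ≤ K`, admissible `g`, `p ∈ branch j g`) for a tower whose operations ARE kernel steps.  So «is (ii) asked for ALL good `f`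
  or only termwise?» (refuter's pricing target on IR-102-1) has the answer print's mechanism gives: [B15] (0.3)∕(0.4) p. 176 and
  (1.100)∕(1.102) p. 201 hold for EVERY density of the class (`Lit.….B15.BasicStep.lmarginal_norm_term`: the normalised term
  `den·N∕∫⌈den` has fibre integral `N` for every fibre-independent `N`, in particular `N = ∫⌈(χ·f)` for any `f`) — at the
  measure level it is one identity per (step, choice), with no `f` left.
* §3 `sum_powerset_prod_eq_one`: `Σ_{p ⊆ s} Π_{c ∈ p} (1 − χ_c) · Π_{c ∈ s∖p} χ_c = 1` (`Finset.prod_add`) — the algebra of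
  [B15] (1.3)–(1.9) p. 178 ∕ (1.88) p. 197 «decomposition of unity 1 = χ + (1 − χ) … expanded» (LOCATORS ONLY; the tree's
  verbatim leaves are `Lit.….B15PrelimIntegrations` ∕ `B15Chi124DetSets`); `GoodClass.prod` (finite products of good functions
  are good; declared in M1's namespace `…B16HistoryIndexedRepr` next to `GoodClass.sum`) and **`hunit_of_powerset`** = (iii) in the END's binder shape for a step whose admissible next choices are the
  subsets of a finite set of cells and whose characteristic functions are the expanded products.
NET for an (A1c) instance presented by kernels `κ K j g p : Kernel (X K (j+1)) (X K j)` and cell indicators: `op := ofKernel`,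
`hstep := hstep_of_kernels … hκ` with `hκ` ONE measure identity per (step, choice), `hunit := hunit_of_powerset …`, the `HwPinned`
weights from `ofKernel_one_le`.  HONEST LIMITS: vacuous alone (no kernel of Bałaban's is named); BY-NAME EFFECT ON THE WALL
(`WALL-NE7b-P1.md` §2): NONE; NE7b NOT proved; count 0∕9.  HONEST DEPENDENCY (cell): continuum YM on T⁴ ⇐ BetaPertH ∧ nine
spine estimates (0∕9 proved); BetaPertH ⇐ (D1) ∧ (D4) ∧ CAP+tail; G-an2-4 gates asym, D1 and NE2∕3∕4.  This file changes
none of it.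
-/

open MeasureTheory ProbabilityTheory Finset
open Summit.QuantumFields.BalabanUV.T4Continuum.B16HistoryIndexedRepr
open Summit.QuantumFields.BalabanUV.T4Continuum.B16HistoryReprChain

namespace Summit.QuantumFields.BalabanUV.T4Continuum.Spine.NE7b.StepKernelOps

noncomputable section

/-! ## §1 A finite transition kernel between two levels IS a relative positive additive map of their bounded-measurable classes -/

section Kernel

variable {X Y : Type} [MeasurableSpace X] [MeasurableSpace Y] (κ : Kernel Y X) [IsFiniteKernel κ]

/-- A good (bounded measurable) function of the source level is integrable against every fibre measure `κ y` of a finite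
kernel. [folklore] -/
theorem integrable_kernel {f : X → ℝ} (hf : (bddMeas X).Gd f) (y : Y) : Integrable f (κ y) :=
  integrable_of_bddMeas (κ y) hf

/-- The real mass of every fibre is at most the kernel's mass letter `κ.bound`. [folklore] -/
theorem real_univ_le_bound (y : Y) : (κ y).real Set.univ ≤ κ.bound.toReal :=
  ENNReal.toReal_mono κ.bound_ne_top (κ.measure_le_bound y Set.univ)

/-- `|∫ f d(κ y)| ≤ |B|·κ.bound` for `|f| ≤ B`. [folklore] -/
theorem abs_integral_kernel_le {f : X → ℝ} {B : ℝ} (hB : ∀ x, |f x| ≤ B) (y : Y) :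
    |∫ x, f x ∂κ y| ≤ |B| * κ.bound.toReal := by
  have h := norm_integral_le_of_norm_le_const (μ := κ y) (f := f) (C := |B|)
    (Filter.Eventually.of_forall fun x => by
      rw [Real.norm_eq_abs]; exact (hB x).trans (le_abs_self B))
  rw [Real.norm_eq_abs] at h
  exact h.trans (mul_le_mul_of_nonneg_left (real_univ_le_bound κ y) (abs_nonneg B))

/-- **THE KERNEL STEP.**  For a finite transition kernel `κ` from the target level `Y` to the source level `X`, the map
`f ↦ (y ↦ ∫ f d(κ y))` is a `RelLinPosHom (bddMeas X) (bddMeas Y)`: it preserves bounded measurability (Mathlib's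
`StronglyMeasurable.integral_kernel`, bound `|B|·κ.bound`) and is monotone, additive and homogeneous on the class. [folklore] -/
def ofKernel : RelLinPosHom (bddMeas X) (bddMeas Y) where
  T f y := ∫ x, f x ∂κ y
  map_good := by
    rintro f ⟨hfm, B, hB⟩
    exact ⟨(hfm.stronglyMeasurable.integral_kernel (κ := κ)).measurable, |B| * κ.bound.toReal,
      fun y => abs_integral_kernel_le κ hB y⟩
  mono hF hG h y := integral_mono (integrable_kernel κ hF y) (integrable_kernel κ hG y) fun x => h x
  add hF hG y := integral_add (integrable_kernel κ hF y) (integrable_kernel κ hG y)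
  smul _ c y := integral_const_mul c _

/-- The kernel step at `f`, `y` is the fibre integral `∫ f d(κ y)`. [folklore] -/
theorem ofKernel_apply (f : X → ℝ) (y : Y) : (ofKernel κ).T f y = ∫ x, f x ∂κ y := rfl

/-- **THE WEIGHT IS THE MASS**: `(ofKernel κ) 1 y = (κ y)(univ)` — the quantity the factor displays (1.79) ∕ (1.89) of [B16]
bound, read at the kernel. [folklore] -/
theorem ofKernel_one (y : Y) : (ofKernel κ).T (fun _ => 1) y = (κ y).real Set.univ := by
  rw [ofKernel_apply, integral_const, smul_eq_mul, mul_one]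

/-- The END's envelope display `op 1 ≤ w` for a kernel step IS a mass bound on the fibres. [folklore] -/
theorem ofKernel_one_le {w : Y → ℝ} (hw : ∀ y, (κ y).real Set.univ ≤ w y) (y : Y) : (ofKernel κ).T (fun _ => 1) y ≤ w y := by
  rw [ofKernel_one]; exact hw y

/-- … in particular the K-uniform letter: `op 1 ≤ κ.bound`. [folklore] -/
theorem ofKernel_one_le_bound (y : Y) : (ofKernel κ).T (fun _ => 1) y ≤ κ.bound.toReal :=
  ofKernel_one_le κ (real_univ_le_bound κ) y

/-- **KERNEL STEPS COMPOSE AS KERNELS**: on the class, the composite of two kernel steps (`RelLinPosHom.comp`, the tower's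
`opsAlong`) is the kernel step of the composed kernel (Mathlib `Kernel.comp`, `Kernel.integral_comp`) — so a one-step operation
assembled from several factors (e.g. averaging after a same-level normalised term after a characteristic function) may be presented
to the END as ONE kernel. [folklore] -/
theorem comp_ofKernel_apply {Z : Type} [MeasurableSpace Z] (η : Kernel Z Y) [IsFiniteKernel η] {f : X → ℝ}
    (hf : (bddMeas X).Gd f) (z : Z) : ((ofKernel η).comp (ofKernel κ)).T f z = (ofKernel (κ ∘ₖ η)).T f z := by
  show ∫ y, (ofKernel κ).T f y ∂η z = ∫ x, f x ∂(κ ∘ₖ η) z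
  simp only [ofKernel_apply]
  rw [Kernel.integral_comp (integrable_of_bddMeas _ hf)]

end Kernel

/-! ## §2 The per-(step, choice) integral identity `hstep` IS one measure identity -/

section Step

variable {X Y : Type} [MeasurableSpace X] [MeasurableSpace Y] (κ : Kernel Y X) [IsFiniteKernel κ]

/-- Integrating the kernel step against a finite measure `ν'` of the target level = integrating against the composite measure
`κ ∘ₘ ν'` of the source level (Mathlib `Kernel.integral_comp`). [folklore] -/
theorem integral_ofKernel (ν' : Measure Y) [IsFiniteMeasure ν'] {f : X → ℝ} (hf : (bddMeas X).Gd f) :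
    ∫ y, (ofKernel κ).T f y ∂ν' = ∫ x, f x ∂(κ ∘ₘ ν') := by
  have hint : Integrable f (κ ∘ₘ ν') := integrable_of_bddMeas _ hf
  simp only [ofKernel_apply]
  rw [Measure.comp_eq_comp_const_apply] at hint ⊢
  rw [Kernel.integral_comp hint, Kernel.const_apply]

/-- **`hstep` FROM ONE MEASURE IDENTITY.**  If the composite measure `κ ∘ₘ ν'` IS the source-level measure `ν` with density `χ ≥ 0`
(`Measure.withDensity`), then the per-(step, choice) identity `∫ (op f) dν' = ∫ χ·f dν` holds for EVERY good `f` — no `f` is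
left in the hypothesis. [folklore] -/
theorem hstep_of_comp_eq (ν : Measure X) (ν' : Measure Y) [IsFiniteMeasure ν'] {χ : X → ℝ} (hχm : Measurable χ)
    (hχ0 : ∀ x, 0 ≤ χ x) (hκ : κ ∘ₘ ν' = ν.withDensity fun x => ENNReal.ofReal (χ x)) {f : X → ℝ}
    (hf : (bddMeas X).Gd f) : ∫ y, (ofKernel κ).T f y ∂ν' = ∫ x, χ x * f x ∂ν := by
  rw [integral_ofKernel κ ν' hf, hκ]
  have e : (fun x => ENNReal.ofReal (χ x)) = fun x => ((χ x).toNNReal : ENNReal) := rfl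
  rw [e, integral_withDensity_eq_integral_smul hχm.real_toNNReal f]
  refine integral_congr_ae (Filter.Eventually.of_forall fun x => ?_)
  show (χ x).toNNReal • f x = χ x * f x
  rw [NNReal.smul_def, smul_eq_mul, Real.coe_toNNReal _ (hχ0 x)]

variable {P : Type} {X' : ℕ → ℕ → Type} [∀ K j, MeasurableSpace (X' K j)]
  (T : (K : ℕ) → Tower P (X' K) (fun j => bddMeas (X' K j)))
  (κs : (K j : ℕ) → (Fin j → P) → P → Kernel (X' K (j + 1)) (X' K j)) [∀ K j g p, IsFiniteKernel (κs K j g p)]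
  (ν : (K j : ℕ) → Measure (X' K j)) [∀ K j, IsFiniteMeasure (ν K j)]
  (χ : (K j : ℕ) → (Fin j → P) → P → X' K j → ℝ) {K₀ : ℕ}

/-- **`hstep` IN THE END's BINDER SHAPE** (`B16HistoryTowerEndDressing.H2A_bddMeas`, display `hstep`): for a tower whose one-step
operations ARE kernel steps (`hop`, by `rfl` in an instance built with `op := ofKernel`), measurable non-negative characteristic
functions, and ONE measure identity per admissible (step, choice) on `j < K`, `K₀ ≤ K` (`hκ`), the per-(step, choice) integral
identity holds for all good `f`. [folklore] -/
theorem hstep_of_kernels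
    (hop : ∀ K j g p (f : X' K j → ℝ) (y : X' K (j + 1)), ((T K).op j g p).T f y = ∫ x, f x ∂κs K j g p y)
    (hχm : ∀ K j g p, Measurable (χ K j g p)) (hχ0 : ∀ K j g p x, 0 ≤ χ K j g p x)
    (hκ : ∀ K, K₀ ≤ K → ∀ j g p, j < K → g ∈ (T K).adm j → p ∈ (T K).branch j g →
      κs K j g p ∘ₘ ν K (j + 1) = (ν K j).withDensity fun x => ENNReal.ofReal (χ K j g p x)) :
    ∀ K, K₀ ≤ K → ∀ j g p, j < K → g ∈ (T K).adm j → p ∈ (T K).branch j g →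
      ∀ f : X' K j → ℝ, (bddMeas (X' K j)).Gd f →
        ∫ y, ((T K).op j g p).T f y ∂ν K (j + 1) = ∫ x, χ K j g p x * f x ∂ν K j := by
  intro K hK j g p hj hg hp f hf
  have e : (fun y => ((T K).op j g p).T f y) = fun y => (ofKernel (κs K j g p)).T f y :=
    funext fun y => by rw [hop, ofKernel_apply]
  rw [e]
  exact hstep_of_comp_eq (κs K j g p) (ν K j) (ν K (j + 1)) (hχm K j g p) (hχ0 K j g p) (hκ K hK j g p hj hg hp) hf

end Step

/-! ## §3 The decomposition of unity `hunit` IS the powerset expansion -/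

section Unity

/-- **`Σ_{p ⊆ s} Π_{c ∈ p} (1 − χ_c) · Π_{c ∈ s∖p} χ_c = 1`** — the expansion of `Π_{c ∈ s} ((1 − χ_c) + χ_c) = 1` over the subsets
`p` of a finite set of cells (`Finset.prod_add`): the algebra of «the decomposition of unity 1 = χ + (1 − χ) … expanded» ([B15]
(1.3)–(1.9) p. 178, (1.88) p. 197 — LOCATORS; verbatim leaves `Lit.….B15PrelimIntegrations`). [folklore] -/
theorem sum_powerset_prod_eq_one {ι R : Type*} [DecidableEq ι] [CommRing R] (s : Finset ι) (χ : ι → R) :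
    ∑ p ∈ s.powerset, (∏ c ∈ p, (1 - χ c)) * ∏ c ∈ s \ p, χ c = 1 := by
  rw [← Finset.prod_add]
  simp

/-- The same, pointwise for cell functions `lf c : C → R` (large-field indicators of the cells). [folklore] -/
theorem sum_powerset_prod_apply_eq_one {ι C R : Type*} [DecidableEq ι] [CommRing R] (s : Finset ι) (lf : ι → C → R)
    (y : C) : ∑ p ∈ s.powerset, (∏ c ∈ p, (1 - lf c y)) * ∏ c ∈ s \ p, lf c y = 1 :=
  sum_powerset_prod_eq_one s fun c => lf c y

/-- Finite products of good functions are good (companion of `GoodClass.sum`, placed next to it in M1's namespace so that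
`𝒢.prod` is available by dot-notation — chair X-SKO N-XSKO-1). [folklore] -/
theorem _root_.Summit.QuantumFields.BalabanUV.T4Continuum.B16HistoryIndexedRepr.GoodClass.prod {C : Type*} (𝒢 : GoodClass C)
    {ι : Type*} (s : Finset ι) (F : ι → C → ℝ) (hF : ∀ i ∈ s, 𝒢.Gd (F i)) : 𝒢.Gd fun x => ∏ i ∈ s, F i x := by
  classical
  induction s using Finset.induction_on with
  | empty => simpa using 𝒢.const 1
  | insert a s ha ih =>
      have h := 𝒢.mul (hF a (Finset.mem_insert_self a s)) (ih fun i hi => hF i (Finset.mem_insert_of_mem hi))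
      simpa [Finset.prod_insert ha] using h

/-- The expanded characteristic function of the choice `p ⊆ s`: `Π_{c ∈ p} (1 − lf c) · Π_{c ∈ s∖p} lf c`. [folklore] -/
def expandedChi {ι C : Type*} [DecidableEq ι] (s : Finset ι) (lf : ι → C → ℝ) (p : Finset ι) : C → ℝ :=
  fun y => (∏ c ∈ p, (1 - lf c y)) * ∏ c ∈ s \ p, lf c y

/-- The expanded characteristic functions are good when the cell functions are. [folklore] -/
theorem expandedChi_good {ι C : Type*} [DecidableEq ι] (𝒢 : GoodClass C) (s : Finset ι) {lf : ι → C → ℝ} (hlf : ∀ c, 𝒢.Gd (lf c))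
    (p : Finset ι) : 𝒢.Gd (expandedChi s lf p) := by
  refine 𝒢.mul (𝒢.prod p _ fun c _ => ?_) (𝒢.prod (s \ p) _ fun c _ => hlf c)
  have h := 𝒢.add (𝒢.const 1) (𝒢.smul (-1) (hlf c))
  refine cast (congrArg 𝒢.Gd (funext fun y => ?_)) h
  ring

/-- The expanded characteristic functions are non-negative when the cell functions take values in `[0, 1]`. [folklore] -/
theorem expandedChi_nonneg {ι C : Type*} [DecidableEq ι] (s : Finset ι) {lf : ι → C → ℝ} (h0 : ∀ c y, 0 ≤ lf c y) (h1 : ∀ c y, lf c y ≤ 1)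
    (p : Finset ι) (y : C) : 0 ≤ expandedChi s lf p y :=
  mul_nonneg (Finset.prod_nonneg fun c _ => sub_nonneg.2 (h1 c y)) (Finset.prod_nonneg fun c _ => h0 c y)

variable {P : Type} [DecidableEq P] {X' : ℕ → ℕ → Type} {𝒢 : (K j : ℕ) → GoodClass (X' K j)}
  (T : (K : ℕ) → Tower (Finset P) (X' K) (𝒢 K)) (cells : (K j : ℕ) → (Fin j → Finset P) → Finset P)
  (lf : (K j : ℕ) → (Fin j → Finset P) → P → X' K j → ℝ) {K₀ : ℕ}

/-- **`hunit` IN THE END's BINDER SHAPE** (`B16HistoryTowerEndDressing.H2A_bddMeas`, display `hunit`): if after the history `g` the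
admissible next choices of step `j` are the subsets of a finite set of cells `cells K j g` (`hbr`) and the step's characteristic
functions are the expanded products of the cells' functions (`hχ`), they sum to one. [folklore] -/
theorem hunit_of_powerset {χ : (K j : ℕ) → (Fin j → Finset P) → Finset P → X' K j → ℝ}
    (hbr : ∀ K j g, (T K).branch j g = (cells K j g).powerset)
    (hχ : ∀ K j g p, χ K j g p = expandedChi (cells K j g) (lf K j g) p) :
    ∀ K, K₀ ≤ K → ∀ j g, j < K → g ∈ (T K).adm j → ∀ y, ∑ p ∈ (T K).branch j g, χ K j g p y = 1 := by
  intro K _ j g _ _ y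
  rw [hbr, Finset.sum_congr rfl fun p _ => by rw [hχ]]
  exact sum_powerset_prod_apply_eq_one (cells K j g) (lf K j g) y

end Unity

end

end Summit.QuantumFields.BalabanUV.T4Continuum.Spine.NE7b.StepKernelOps
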